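import Summits.QuantumFields.BalabanUV.T4Continuum.Support.VectorBlockTrialFormCovariant
import Summits.QuantumFields.BalabanUV.T4Continuum.Support.VariationalCovariantAssemblySqrt

/-!
# T⁴ programme, spine node NE2 (U1a), lane P2 (variational) — THE VECTOR SECTOR'S FORM FIXED (road owner, §2.E of the skeleton, decisions (D1)–(D4)):
# the covariant CURL form + a DATA gauge∕curvature term over the FULL fibre of the transported (1.18) average, leaf V-UB DISCHARGED for it,
# and THE VECTOR CANONICAL-PAIR BRACKET with the remaining leaves (V-P, V-FED, V-ONE, V-REG, fine V-UB) displayed in vector letters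

Road owner `b2b-balaban-t4-ne2-p2` gen 11 (`prover-b2b-balaban-t4-ne2-p2-g11-0`); skeleton `t4/skeletons/NE2-t4-ne2-p2.md` v0.14 §2.E; journal
CLAIMS.log 2026-08-20 «V-D FORM FIXED».  On top of leaf-03-g4's `VectorBlockTrialFormCovariant` (p215552: `nsqV`, `QvT`, `compV`, `roughV`,
`QvT_compV`, `physRoughV_compV_le` — THE vector averaging of record and leaf V-UB for the rough form, BY NAME) and of the abstract bracket
`VariationalCovariantAssemblySqrt.pair_bracket_sqrt` (p212859, type-generic, BY NAME).

DECISIONS RECORDED HERE (model level; `E` a normed ℂ-space, finite-dimensional where minimisers are needed; all transports DATA `E →L[ℂ] E`):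
(D1) NO constraint subspace ∕ gauge condition inside the fibre — the value is `blockSpin (QvT n M Tl) (ScV n M R G)` over the FULL fibre `{W : QvT W = φ}`
(at `U = 1` the printed `R∂*A = 0` of [B5] (1.63) selects the minimiser, not the value); (D2) THE FORM `ScV n M R G W := n^{−d}·(n²·(½·curlSq R W + G W))`,
`curlV R W x μ ν := D_μW_ν(x) − D_νW_μ(x)`, `D_μW_ν(x) := R(x,μ)(W(x+e_μ,ν)) − W(x,ν)` (`cdV`; [B9] (3.3)–(3.4) SHAPE, at `U = 1` [B5] (1.21)), `G` a DATA
functional = the gauge term `⟨D*_U W, R(U) D*_U W⟩` of [B9] (3.26) plus the zeroth-order curvature coupling, with (GF0) `0 ≤ G`, continuity, and (GF1)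
`G W ≤ C_G·roughV R W + C₀·nsqV W` (honest sizes `C_G ≈ d·‖R(U)‖`, `n²·C₀ ≲ n²·a = O(1)` under the plaquette class); (D3) leaf V-P displayed in P⁺'s shape
for the pair `(ScV, QvT)`; (D4) the averaging of record is leaf-03-g4's `QvT`.
CONTENT: §1 `cdV`∕`curlV`∕`curlSq`, `curlSq_le_four_mul_rough` (`curlSq ≤ 4·roughV`); §2 the pair's forms `ScV`∕`SfV`, sizes `qWV`∕`qVV`, continuity,
`norm_sq_le_nsqV`, `continuous_QvT`, `QvT_surjective`; §3 leaf V-UB DISCHARGED for the fixed form (`norm_compV_le`, `nsqV_compV_le`, `qWV_compV_le`,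
`ScV_compV_le`, `exists_ubV`; k-uniform constant `lamV d (n·w) C_G (n²·C₀) := (60·6^{d−1})²·(2d(2 + C_G)((2 + n w)² + 9) + n²C₀)`);
§4 **`vector_pair_bracket_sqrt`** = `pair_bracket_sqrt` on 1-form carriers with `Sc := ScV n M R G`, `Sf := SfV n L M R′ G′`, `qZ := nsqV M` and the
averagings `Qk`, `Q₁` DATA (continuous, `Q₁` onto: the line-indexed `QvL` class of N-ne2leaf03g4-1 for the tower, or `QvT`); leaves V-UB∕V-P (both levels),
V-FED, V-ONE (square-root shape), V-REG DISPLAYED — one target signature per supplier leaf; `vector_pair_bracket_sqrt_bond` = the one-step special case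
`Qk := QvT n M Tl`, `Q₁ := QvT L (fine n M) Tl′` with the coarse V-UB DISCHARGED by §3.

HONEST FRAMING (T4-DAG p. 1).  Model level; transports and `G` are DATA; nothing of the displayed leaves is proved here; the identification of `G` with
[B9] (3.26)'s gauge term and of `QvT`'s line transports with Bałaban's contour transports is the b05∕b09 dictionary, not a theorem; [folklore] lattice
calculus; data `def`s only (`cdV`, `curlV`, `curlSq`, `ScV`, `SfV`, `qWV`, `qVV`, `lamV`), no `def … : Prop`, no `sorry`; axioms standard.  NE2 NOT
proved; spine 0/9; rung (B)+1 finite T⁴ — NOT infinite volume, NOT mass gap, NOT Clay.  HONEST DEPENDENCY (cell, verbatim): continuum YM on T⁴ ⇐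
BetaPertH ∧ nine spine estimates (0/9 proved); BetaPertH ⇐ (D1) ∧ (D4) ∧ CAP+tail; G-an2-4 gates asym, D1 and NE2/3/4.
-/

noncomputable section

namespace Summit.QuantumFields.BalabanUV.T4Continuum.VariationalVectorForm

open Finset
open scoped ComplexConjugate
open Literature.MathematicalPhysics.QuantumFieldTheory.Balaban1983to89.B5Prop11Plancherel (Tor fine unitVec)
open Literature.MathematicalPhysics.QuantumFieldTheory.Balaban1983to89.B5Block118 (tstep bpt)
open Literature.MathematicalPhysics.QuantumFieldTheory.Balaban1983to89.B5AverageCurlStokes (sum_blocks_real)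
open Literature.MathematicalPhysics.QuantumFieldTheory.Balaban1983to89.B5Blocks16 (blockOf blockOf_bpt)
open Summit.QuantumFields.BalabanUV.T4Continuum.ScalarBlockTrialFunction
open Summit.QuantumFields.BalabanUV.T4Continuum.VectorBlockTrialForm
open Summit.QuantumFields.BalabanUV.T4Continuum.VariationalTransfer (blockSpin)
open Summit.QuantumFields.BalabanUV.T4Continuum.VariationalCovariantAssemblySqrt (pair_bracket_sqrt)

variable {d : ℕ} {E : Type*} [NormedAddCommGroup E] [NormedSpace ℂ E]

/-! ## §1 Covariant first differences of a 1-form, the curl, and `curlSq ≤ 4·rough` -/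

section Curl
variable (N : Fin d → ℕ) [∀ μ, NeZero (N μ)]

/-- the covariant forward `μ`-difference of the `ν`-component: `D_μW_ν(x) = R(x,μ)(W(x+e_μ, ν)) − W(x, ν)` ([B9] (3.3) SHAPE; transports DATA). [folklore] -/
def cdV (R : Tor N → Fin d → (E →L[ℂ] E)) (W : Tor N → Fin d → E) (x : Tor N) (μ ν : Fin d) : E :=
  R x μ (W (x + unitVec N μ) ν) - W x ν

/-- the covariant lattice curl `(D W)_{μν}(x) = D_μW_ν(x) − D_νW_μ(x)` ([B9] (3.4) SHAPE; at `U = 1` the plaquette variable of [B5] (1.21)). [folklore] -/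
def curlV (R : Tor N → Fin d → (E →L[ℂ] E)) (W : Tor N → Fin d → E) (x : Tor N) (μ ν : Fin d) : E :=
  cdV N R W x μ ν - cdV N R W x ν μ

/-- the curl form in lattice units, over ORDERED pairs `(μ, ν)` (each plaquette twice): `Σ_{x,μ,ν}‖(D W)_{μν}(x)‖²`. [folklore] -/
def curlSq (R : Tor N → Fin d → (E →L[ℂ] E)) (W : Tor N → Fin d → E) : ℝ := ∑ x, ∑ μ, ∑ ν, ‖curlV N R W x μ ν‖ ^ 2

/-- `0 ≤ curlSq`. [folklore] -/
theorem curlSq_nonneg (R : Tor N → Fin d → (E →L[ℂ] E)) (W : Tor N → Fin d → E) : 0 ≤ curlSq N R W := by unfold curlSq; positivity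

omit [NormedSpace ℂ E] in
/-- `‖a − b‖² ≤ 2‖a‖² + 2‖b‖²`. [folklore] -/
theorem norm_sub_sq_le_two (a b : E) : ‖a - b‖ ^ 2 ≤ 2 * ‖a‖ ^ 2 + 2 * ‖b‖ ^ 2 := by
  have h := norm_sub_le a b
  nlinarith [norm_nonneg (a - b), norm_nonneg a, norm_nonneg b, sq_nonneg (‖a‖ - ‖b‖)]

omit [∀ μ, NeZero (N μ)] in
/-- `cdV` is continuous in the 1-form. [folklore] -/
theorem continuous_cdV (R : Tor N → Fin d → (E →L[ℂ] E)) (x : Tor N) (μ ν : Fin d) :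
    Continuous fun W : Tor N → Fin d → E => cdV N R W x μ ν := by
  unfold cdV
  exact ((R x μ).continuous.comp ((continuous_apply ν).comp (continuous_apply _))).sub
    ((continuous_apply ν).comp (continuous_apply x))

/-- `curlSq` is continuous in the 1-form. [folklore] -/
theorem continuous_curlSq (R : Tor N → Fin d → (E →L[ℂ] E)) : Continuous fun W : Tor N → Fin d → E => curlSq N R W := by
  unfold curlSq curlV
  exact continuous_finsetSum _ fun x _ => continuous_finsetSum _ fun μ _ => continuous_finsetSum _ fun ν _ =>
    (((continuous_cdV N R x μ ν).sub (continuous_cdV N R x ν μ)).norm).pow 2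

end Curl

section Rough
variable (n : ℕ) [NeZero n] (M : Fin d → ℕ) [hM : ∀ μ, NeZero (M μ)]

/-- leaf-03-g4's rough form reindexed: `roughV R W = Σ_{x,μ,ν}‖D_μW_ν(x)‖²`. [folklore] -/
theorem roughV_eq (R : Tor (fine n M) → Fin d → (E →L[ℂ] E)) (W : Tor (fine n M) → Fin d → E) :
    roughV n M R W = ∑ x, ∑ μ, ∑ ν, ‖cdV (fine n M) R W x μ ν‖ ^ 2 := by
  unfold roughV cdV
  calc ∑ ν, ∑ μ, ∑ x, ‖R x ν (W (x + unitVec (fine n M) ν) μ) - W x μ‖ ^ 2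
      = ∑ ν, ∑ x, ∑ μ, ‖R x ν (W (x + unitVec (fine n M) ν) μ) - W x μ‖ ^ 2 := Finset.sum_congr rfl fun ν _ => Finset.sum_comm
    _ = ∑ x, ∑ ν, ∑ μ, ‖R x ν (W (x + unitVec (fine n M) ν) μ) - W x μ‖ ^ 2 := Finset.sum_comm

omit [NeZero n] in
/-- **the curl form is dominated by the rough form**: `curlSq ≤ 4·roughV` (termwise `‖a − b‖² ≤ 2‖a‖² + 2‖b‖²`, then both halves are the rough
form up to the order of summation). [folklore] -/
theorem curlSq_le_four_mul_rough [NeZero n] (R : Tor (fine n M) → Fin d → (E →L[ℂ] E)) (W : Tor (fine n M) → Fin d → E) :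
    curlSq (fine n M) R W ≤ 4 * roughV n M R W := by
  have hswap : ∑ x, ∑ μ, ∑ ν, ‖cdV (fine n M) R W x ν μ‖ ^ 2 = ∑ x, ∑ μ, ∑ ν, ‖cdV (fine n M) R W x μ ν‖ ^ 2 :=
    Finset.sum_congr rfl fun x _ => Finset.sum_comm
  unfold curlSq curlV
  calc ∑ x, ∑ μ, ∑ ν, ‖cdV (fine n M) R W x μ ν - cdV (fine n M) R W x ν μ‖ ^ 2
      ≤ ∑ x, ∑ μ, ∑ ν, (2 * ‖cdV (fine n M) R W x μ ν‖ ^ 2 + 2 * ‖cdV (fine n M) R W x ν μ‖ ^ 2) := by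
        gcongr with x _ μ _ ν _
        exact norm_sub_sq_le_two _ _
    _ = 2 * ∑ x, ∑ μ, ∑ ν, ‖cdV (fine n M) R W x μ ν‖ ^ 2 + 2 * ∑ x, ∑ μ, ∑ ν, ‖cdV (fine n M) R W x ν μ‖ ^ 2 := by
        simp only [sum_add_distrib, mul_sum]
    _ = 4 * roughV n M R W := by rw [hswap, roughV_eq]; ring

end Rough

/-! ## §2 The forms of the vector canonical pair, sizes, continuity -/

section Forms
variable (n L : ℕ) [NeZero n] [NeZero L] (M : Fin d → ℕ) [hM : ∀ μ, NeZero (M μ)]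

/-- **THE VECTOR FORM AT LEVEL `n` (decision (D2))**: `ScV R G W = n^{−d}·(n²·(½·curlSq R W + G W))` — covariant curl form plus the DATA gauge∕curvature
functional `G`, physical normalisation `n^{2−d}` against the unit torus. [folklore] -/
def ScV (R : Tor (fine n M) → Fin d → (E →L[ℂ] E)) (G : (Tor (fine n M) → Fin d → E) → ℝ) (W : Tor (fine n M) → Fin d → E) : ℝ :=
  ((n : ℝ) ^ d)⁻¹ * ((n : ℝ) ^ 2 * (curlSq (fine n M) R W / 2 + G W))

/-- the same form at level `n·L` in one-step coordinates `fine L (fine n M)`. [folklore] -/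
def SfV (R' : Tor (fine L (fine n M)) → Fin d → (E →L[ℂ] E)) (G' : (Tor (fine L (fine n M)) → Fin d → E) → ℝ)
    (W' : Tor (fine L (fine n M)) → Fin d → E) : ℝ :=
  (((n : ℝ) * L) ^ d)⁻¹ * (((n : ℝ) * L) ^ 2 * (curlSq (fine L (fine n M)) R' W' / 2 + G' W'))

/-- the P⁺ size at level `n`: `qWV W = n^{−d}·Σ_{x,μ}‖W(x,μ)‖²`. [folklore] -/
def qWV (W : Tor (fine n M) → Fin d → E) : ℝ := ((n : ℝ) ^ d)⁻¹ * nsqV (fine n M) W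

/-- the P⁺ size at level `n·L`. [folklore] -/
def qVV (W' : Tor (fine L (fine n M)) → Fin d → E) : ℝ := (((n : ℝ) * L) ^ d)⁻¹ * nsqV (fine L (fine n M)) W'

/-- `0 ≤ ScV` when `0 ≤ G` (GF0). [folklore] -/
theorem ScV_nonneg (R : Tor (fine n M) → Fin d → (E →L[ℂ] E)) {G : (Tor (fine n M) → Fin d → E) → ℝ} (hG0 : ∀ W, 0 ≤ G W)
    (W : Tor (fine n M) → Fin d → E) : 0 ≤ ScV n M R G W := by
  have := curlSq_nonneg (fine n M) R W
  have := hG0 W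
  unfold ScV; positivity

/-- `0 ≤ SfV` when `0 ≤ G′`. [folklore] -/
theorem SfV_nonneg (R' : Tor (fine L (fine n M)) → Fin d → (E →L[ℂ] E)) {G' : (Tor (fine L (fine n M)) → Fin d → E) → ℝ}
    (hG0' : ∀ W', 0 ≤ G' W') (W' : Tor (fine L (fine n M)) → Fin d → E) : 0 ≤ SfV n L M R' G' W' := by
  have := curlSq_nonneg (fine L (fine n M)) R' W'
  have := hG0' W'
  unfold SfV; positivity

omit [NormedSpace ℂ E] in
/-- `0 ≤ qWV`. [folklore] -/
theorem qWV_nonneg (W : Tor (fine n M) → Fin d → E) : 0 ≤ qWV n M W := mul_nonneg (by positivity) (nsqV_nonneg _ W)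

omit [NormedSpace ℂ E] in
/-- `0 ≤ qVV`. [folklore] -/
theorem qVV_nonneg (W' : Tor (fine L (fine n M)) → Fin d → E) : 0 ≤ qVV n L M W' := mul_nonneg (by positivity) (nsqV_nonneg _ W')

/-- `ScV` is continuous when `G` is. [folklore] -/
theorem continuous_ScV (R : Tor (fine n M) → Fin d → (E →L[ℂ] E)) {G : (Tor (fine n M) → Fin d → E) → ℝ} (hGc : Continuous G) :
    Continuous (ScV n M R G) := by
  unfold ScV
  exact continuous_const.mul (continuous_const.mul (((continuous_curlSq (fine n M) R).div_const 2).add hGc))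

/-- `SfV` is continuous when `G′` is. [folklore] -/
theorem continuous_SfV (R' : Tor (fine L (fine n M)) → Fin d → (E →L[ℂ] E)) {G' : (Tor (fine L (fine n M)) → Fin d → E) → ℝ}
    (hGc' : Continuous G') : Continuous (SfV n L M R' G') := by
  unfold SfV
  exact continuous_const.mul (continuous_const.mul (((continuous_curlSq (fine L (fine n M)) R').div_const 2).add hGc'))

omit [NormedSpace ℂ E] in
/-- the sup norm of a 1-form is dominated by its `ℓ²` mass: `‖W‖² ≤ nsqV W`. [folklore] -/
theorem norm_sq_le_nsqV {N : Fin d → ℕ} [∀ μ, NeZero (N μ)] (W : Tor N → Fin d → E) : ‖W‖ ^ 2 ≤ nsqV N W := by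
  have h0 : 0 ≤ nsqV N W := nsqV_nonneg N W
  have hle : ∀ y μ, ‖W y μ‖ ^ 2 ≤ nsqV N W := fun y μ => by
    unfold nsqV
    calc ‖W y μ‖ ^ 2 ≤ ∑ ν, ‖W y ν‖ ^ 2 := Finset.single_le_sum (f := fun ν => ‖W y ν‖ ^ 2) (fun _ _ => by positivity) (Finset.mem_univ μ)
      _ ≤ ∑ z, ∑ ν, ‖W z ν‖ ^ 2 := Finset.single_le_sum (f := fun z => ∑ ν, ‖W z ν‖ ^ 2)
          (fun _ _ => sum_nonneg fun _ _ => by positivity) (Finset.mem_univ y)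
  have h : ‖W‖ ≤ Real.sqrt (nsqV N W) := by
    refine (pi_norm_le_iff_of_nonneg (Real.sqrt_nonneg _)).mpr fun y => (pi_norm_le_iff_of_nonneg (Real.sqrt_nonneg _)).mpr fun μ => ?_
    rw [← Real.sqrt_sq (norm_nonneg (W y μ))]
    exact Real.sqrt_le_sqrt (hle y μ)
  calc ‖W‖ ^ 2 ≤ Real.sqrt (nsqV N W) ^ 2 := pow_le_pow_left₀ (norm_nonneg _) h 2
    _ = nsqV N W := Real.sq_sqrt h0

omit [NeZero n] hM in
/-- the transported average is continuous. [folklore] -/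
theorem continuous_QvT (Tl : Tor (fine n M) → Fin d → (E →L[ℂ] E)) : Continuous (QvT n M Tl) := by
  refine continuous_pi fun y => continuous_pi fun μ => ?_
  simp only [QvT]
  exact continuous_const.smul (continuous_finsetSum _ fun j _ => continuous_finsetSum _ fun t _ =>
    (Tl _ μ).continuous.comp ((continuous_apply μ).comp (continuous_apply _)))

/-- the transported average with right inverses is onto (`QvT_compV`). [folklore] -/
theorem QvT_surjective {Tl Sl : Tor (fine n M) → Fin d → (E →L[ℂ] E)} (hTS : ∀ x μ v, Tl x μ (Sl x μ v) = v) :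
    Function.Surjective (QvT n M Tl) := fun φ => ⟨_, QvT_compV n M hTS φ⟩

end Forms

/-! ## §3 Leaf V-UB DISCHARGED for the fixed form -/

section UB
variable (n : ℕ) [NeZero n] (M : Fin d → ℕ) [hM : ∀ μ, NeZero (M μ)]

/-- the competitor is pointwise `≤ κ⁻¹·‖φ(block, μ)‖` (`|W·a| ≤ 1`, `‖S_l‖ ≤ 1`). [folklore] -/
theorem norm_compV_le {Sl : Tor (fine n M) → Fin d → (E →L[ℂ] E)} (hS : ∀ x μ, ‖Sl x μ‖ ≤ 1) (φ : Tor M → Fin d → E)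
    (x : Tor (fine n M)) (μ : Fin d) : ‖compV n M Sl φ x μ‖ ≤ (kappaV d n)⁻¹ * ‖φ (blockOf n M x) μ‖ := by
  have hκ := kappaV_pos (Nat.succ_le_of_lt (Fin.pos μ)) (Nat.pos_of_ne_zero (NeZero.ne n))
  have ht : ‖trialV n M φ x μ‖ ≤ ‖φ (blockOf n M x) μ‖ := by
    unfold trialV
    rw [norm_smul, Complex.norm_real, Real.norm_eq_abs]
    exact mul_le_of_le_one_left (norm_nonneg _) (abs_weight_le_one n _ μ)
  unfold compV
  calc _ ≤ ‖Sl x μ‖ * ‖(((kappaV d n)⁻¹ : ℝ) : ℂ) • trialV n M φ x μ‖ := ContinuousLinearMap.le_opNorm _ _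
    _ ≤ 1 * ((kappaV d n)⁻¹ * ‖φ (blockOf n M x) μ‖) := by
        refine mul_le_mul (hS x μ) ?_ (norm_nonneg _) zero_le_one
        rw [norm_smul, Complex.norm_real, Real.norm_eq_abs, abs_of_pos (inv_pos.mpr hκ)]
        exact mul_le_mul_of_nonneg_left ht (inv_pos.mpr hκ).le
    _ = _ := one_mul _

/-- the competitor's `ℓ²` mass: `nsqV (compV φ) ≤ κ⁻²·n^d·nsqV φ`. [folklore] -/
theorem nsqV_compV_le {Sl : Tor (fine n M) → Fin d → (E →L[ℂ] E)} (hS : ∀ x μ, ‖Sl x μ‖ ≤ 1) (φ : Tor M → Fin d → E) :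
    nsqV (fine n M) (compV n M Sl φ) ≤ ((kappaV d n)⁻¹) ^ 2 * ((n : ℝ) ^ d * nsqV M φ) := by
  have hcard : (Fintype.card (Fin d → Fin n) : ℝ) = (n : ℝ) ^ d := by
    rw [Fintype.card_fun, Fintype.card_fin, Fintype.card_fin]; push_cast; ring
  unfold nsqV
  calc ∑ x, ∑ μ, ‖compV n M Sl φ x μ‖ ^ 2 ≤ ∑ x, ∑ μ, ((kappaV d n)⁻¹ * ‖φ (blockOf n M x) μ‖) ^ 2 := by
        gcongr with x _ μ _
        exact norm_compV_le n M hS φ x μ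
    _ = ((kappaV d n)⁻¹) ^ 2 * ∑ x, ∑ μ, ‖φ (blockOf n M x) μ‖ ^ 2 := by simp only [mul_pow, mul_sum]
    _ = ((kappaV d n)⁻¹) ^ 2 * ((n : ℝ) ^ d * ∑ y, ∑ μ, ‖φ y μ‖ ^ 2) := by
        congr 1
        rw [sum_blocks_real n M (fun x => ∑ μ, ‖φ (blockOf n M x) μ‖ ^ 2), mul_sum]
        refine Finset.sum_congr rfl fun y _ => ?_
        simp only [blockOf_bpt]
        rw [sum_const, card_univ, nsmul_eq_mul, hcard]

/-- the competitor's P⁺ size: `qWV (compV φ) ≤ (60·6^{d−1})²·nsqV φ` (`κ⁻¹ ≤ 60·6^{d−1}`). [folklore] -/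
theorem qWV_compV_le {Sl : Tor (fine n M) → Fin d → (E →L[ℂ] E)} (hS : ∀ x μ, ‖Sl x μ‖ ≤ 1) (hd : 1 ≤ d) (φ : Tor M → Fin d → E) :
    qWV n M (compV n M Sl φ) ≤ (60 * (6 : ℝ) ^ (d - 1)) ^ 2 * nsqV M φ := by
  have hn : 0 < n := Nat.pos_of_ne_zero (NeZero.ne n)
  have hn0 : (0 : ℝ) < (n : ℝ) ^ d := by positivity
  have hκ0 := kappaV_pos hd hn
  obtain ⟨hκ, -⟩ := kappaV_bounds hd hn
  have hc : (kappaV d n)⁻¹ ≤ 60 * (6 : ℝ) ^ (d - 1) := by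
    rw [inv_le_comm₀ hκ0 (by positivity)]
    calc (60 * (6 : ℝ) ^ (d - 1))⁻¹ = ((1 : ℝ) / 6) ^ (d - 1) / 60 := by rw [one_div, inv_pow]; ring
      _ ≤ kappaV d n := hκ
  have hc2 : ((kappaV d n)⁻¹) ^ 2 ≤ (60 * (6 : ℝ) ^ (d - 1)) ^ 2 := pow_le_pow_left₀ (inv_nonneg.mpr hκ0.le) hc 2
  have hφ := nsqV_nonneg M φ
  unfold qWV
  calc ((n : ℝ) ^ d)⁻¹ * nsqV (fine n M) (compV n M Sl φ) ≤ ((n : ℝ) ^ d)⁻¹ * (((kappaV d n)⁻¹) ^ 2 * ((n : ℝ) ^ d * nsqV M φ)) :=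
        mul_le_mul_of_nonneg_left (nsqV_compV_le n M hS φ) (by positivity)
    _ = ((kappaV d n)⁻¹) ^ 2 * nsqV M φ := by field_simp
    _ ≤ _ := mul_le_mul_of_nonneg_right hc2 hφ

/-- **THE k-UNIFORM V-UB CONSTANT OF THE FIXED FORM**: `lamV d x C_G c₀ = (60·6^{d−1})²·(2d·(2 + C_G)·((2 + x)² + 9) + c₀)` at `x = n·w`, `c₀ = n²·C₀`. [folklore] -/
def lamV (d : ℕ) (x CG c₀ : ℝ) : ℝ := (60 * (6 : ℝ) ^ (d - 1)) ^ 2 * (2 * d * (2 + CG) * ((2 + x) ^ 2 + 9) + c₀)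

omit [NeZero n] hM in
/-- `0 ≤ lamV` for nonnegative budgets. [folklore] -/
theorem lamV_nonneg {x CG c₀ : ℝ} (hCG : 0 ≤ CG) (hc : 0 ≤ c₀) : 0 ≤ lamV d x CG c₀ := by unfold lamV; positivity

/-- **LEAF V-UB FOR THE FIXED FORM, DISCHARGED**: `ScV (compV φ) ≤ lamV d (n w) C_G (n²C₀)·nsqV φ` — curl `≤ 4·rough` (§1), (GF1), leaf-03-g4's
`physRoughV_compV_le` for the rough part and `qWV_compV_le` for the zeroth-order part. [folklore] -/
theorem ScV_compV_le {Tl Sl : Tor (fine n M) → Fin d → (E →L[ℂ] E)} (hTS : ∀ x μ v, Tl x μ (Sl x μ v) = v) (hT : ∀ x μ, ‖Tl x μ‖ ≤ 1)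
    (hS : ∀ x μ, ‖Sl x μ‖ ≤ 1) {R : Tor (fine n M) → Fin d → (E →L[ℂ] E)} (hR : ∀ x ν, ‖R x ν‖ ≤ 1) {w : ℝ} (hw0 : 0 ≤ w)
    (hw : ∀ (y : Tor M) (j : Fin d → Fin n) (ν μ : Fin d), (j ν : ℕ) + 1 < n → ‖R (bpt n M y j) ν * Sl (bpt n M y j + unitVec (fine n M) ν) μ * Tl (bpt n M y j) μ - 1‖ ≤ w)
    (hd : 1 ≤ d) {G : (Tor (fine n M) → Fin d → E) → ℝ} {CG C₀ : ℝ} (hCG : 0 ≤ CG) (hC₀ : 0 ≤ C₀)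
    (hG : ∀ W, G W ≤ CG * roughV n M R W + C₀ * nsqV (fine n M) W) (φ : Tor M → Fin d → E) :
    ScV n M R G (compV n M Sl φ) ≤ lamV d (n * w) CG ((n : ℝ) ^ 2 * C₀) * nsqV M φ := by
  set W := compV n M Sl φ with hW
  have hn0 : (0 : ℝ) < (n : ℝ) ^ d := by have := Nat.pos_of_ne_zero (NeZero.ne n); positivity
  have hrough := physRoughV_compV_le n M hTS hT hS hR hw0 hw hd φ; have hmass := qWV_compV_le n M hS hd φ
  have hcurl := curlSq_le_four_mul_rough n M R W; have hr0 := roughV_nonneg n M R W; have hφ := nsqV_nonneg M φ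
  rw [← hW] at hrough hmass; unfold qWV at hmass
  have h1 : curlSq (fine n M) R W / 2 + G W ≤ (2 + CG) * roughV n M R W + C₀ * nsqV (fine n M) W := by linarith [hG W]
  calc ScV n M R G W ≤ ((n : ℝ) ^ d)⁻¹ * ((n : ℝ) ^ 2 * ((2 + CG) * roughV n M R W + C₀ * nsqV (fine n M) W)) := by
        unfold ScV; gcongr
    _ = (2 + CG) * (((n : ℝ) ^ d)⁻¹ * ((n : ℝ) ^ 2 * roughV n M R W)) + (n : ℝ) ^ 2 * C₀ * (((n : ℝ) ^ d)⁻¹ * nsqV (fine n M) W) := by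
        ring
    _ ≤ (2 + CG) * (2 * d * (60 * (6 : ℝ) ^ (d - 1)) ^ 2 * ((2 + n * w) ^ 2 + 9) * nsqV M φ)
        + (n : ℝ) ^ 2 * C₀ * ((60 * (6 : ℝ) ^ (d - 1)) ^ 2 * nsqV M φ) := by gcongr
    _ = lamV d (n * w) CG ((n : ℝ) ^ 2 * C₀) * nsqV M φ := by unfold lamV; ring

/-- **LEAF V-UB, `∃`-FORM (the `hUBc` binder of the bracket)**: `∀ φ, ∃ W, QvT W = φ ∧ ScV W ≤ lamV·nsqV φ`. [folklore] -/
theorem exists_ubV {Tl Sl : Tor (fine n M) → Fin d → (E →L[ℂ] E)} (hTS : ∀ x μ v, Tl x μ (Sl x μ v) = v) (hT : ∀ x μ, ‖Tl x μ‖ ≤ 1)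
    (hS : ∀ x μ, ‖Sl x μ‖ ≤ 1) {R : Tor (fine n M) → Fin d → (E →L[ℂ] E)} (hR : ∀ x ν, ‖R x ν‖ ≤ 1) {w : ℝ} (hw0 : 0 ≤ w)
    (hw : ∀ (y : Tor M) (j : Fin d → Fin n) (ν μ : Fin d), (j ν : ℕ) + 1 < n → ‖R (bpt n M y j) ν * Sl (bpt n M y j + unitVec (fine n M) ν) μ * Tl (bpt n M y j) μ - 1‖ ≤ w)
    (hd : 1 ≤ d) {G : (Tor (fine n M) → Fin d → E) → ℝ} {CG C₀ : ℝ} (hCG : 0 ≤ CG) (hC₀ : 0 ≤ C₀)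
    (hG : ∀ W, G W ≤ CG * roughV n M R W + C₀ * nsqV (fine n M) W) :
    ∀ φ : Tor M → Fin d → E, ∃ W : Tor (fine n M) → Fin d → E, QvT n M Tl W = φ ∧
      ScV n M R G W ≤ lamV d (n * w) CG ((n : ℝ) ^ 2 * C₀) * nsqV M φ :=
  fun φ => ⟨_, QvT_compV n M hTS φ, ScV_compV_le n M hTS hT hS hR hw0 hw hd hCG hC₀ hG φ⟩

end UB

/-! ## §4 The vector canonical-pair bracket -/

section Pair
variable (n L : ℕ) [NeZero n] [NeZero L] (M : Fin d → ℕ) [hM : ∀ μ, NeZero (M μ)]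

/-- **THE ADDITIVE BRACKET FOR THE VECTOR CANONICAL PAIR, AVERAGINGS DATA** (model level; `E` finite-dimensional): forms `ScV R G` (level `n`) and
`SfV R′ G′` (level `n·L`) as fixed in (D2) with (GF0) and continuity; averagings `Qk`, `Q₁` ANY continuous maps with `Q₁` onto — the LINE-indexed
carriers `QvL` of leaf-03-g4's N-ne2leaf03g4-1 (closed under composition: V-COMP, the tower) or the BOND-indexed `QvT` (one step; corollary below);
ASSUMING the leaves as displayed binders in vector letters — V-UB (both levels, `Λ`), V-P (both levels, `C_P`), V-FED (`δ`), V-ONE (square-root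
shape, `ε₁`, `δ′`, functional `ρ`), V-REG (`C_R`) — for every unit datum `φ` the two one-sided brackets between `Δ_k := blockSpin Qk (ScV R G)` and
`Δ_{k+1} := blockSpin (Qk ∘ Q₁) (SfV R′ G′)` with `e = 2δ√(Λ·C_P(Λ+1)) + δ²·C_P(Λ+1)`, `e′ = ε₁C_R(Λ+1) + 2δ′√((Λ + ε₁C_R(Λ+1))·C_P(Λ+1)) + δ′²·C_P(Λ+1)`
(`pair_bracket_sqrt` on `V = Tor (fine L (fine n M)) → Fin d → E`, `W = Tor (fine n M) → Fin d → E`, `Z = Tor M → Fin d → E`, `qZ = nsqV M`). [folklore] -/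
theorem vector_pair_bracket_sqrt [FiniteDimensional ℂ E]
    {R : Tor (fine n M) → Fin d → (E →L[ℂ] E)} {R' : Tor (fine L (fine n M)) → Fin d → (E →L[ℂ] E)}
    {G : (Tor (fine n M) → Fin d → E) → ℝ} {G' : (Tor (fine L (fine n M)) → Fin d → E) → ℝ}
    {Qk : (Tor (fine n M) → Fin d → E) → (Tor M → Fin d → E)} {Q₁ : (Tor (fine L (fine n M)) → Fin d → E) → (Tor (fine n M) → Fin d → E)}
    (hQk : Continuous Qk) (hQ₁ : Continuous Q₁) (hsurj : Function.Surjective Q₁)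
    (hG0 : ∀ W, 0 ≤ G W) (hGc : Continuous G) (hG0' : ∀ W', 0 ≤ G' W') (hGc' : Continuous G')
    {Λ CP CR δ ε₁ δ' : ℝ} (hΛ : 0 ≤ Λ) (hCP : 0 ≤ CP) (hCR : 0 ≤ CR) (hδ : 0 ≤ δ) (hε₁ : 0 ≤ ε₁) (hδ' : 0 ≤ δ')
    {ρ : (Tor (fine n M) → Fin d → E) → ℝ} (hρ0 : ∀ W, 0 ≤ ρ W)
    -- leaf V-UB at both levels
    (hUBc : ∀ φ : Tor M → Fin d → E, ∃ W, Qk W = φ ∧ ScV n M R G W ≤ Λ * nsqV M φ)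
    (hUBf : ∀ φ : Tor M → Fin d → E, ∃ W', Qk (Q₁ W') = φ ∧ SfV n L M R' G' W' ≤ Λ * nsqV M φ)
    -- leaf V-P at both levels (P⁺'s shape for the pair (form, average))
    (hPc : ∀ W, qWV n M W ≤ CP * (ScV n M R G W + nsqV M (Qk W)))
    (hPf : ∀ W', qVV n L M W' ≤ CP * (SfV n L M R' G' W' + nsqV M (Qk (Q₁ W'))))
    -- leaf V-FED (covariant Federbush for the curl form + one-step consistency of G, additive square-root shape)
    (hFED : ∀ W', ScV n M R G (Q₁ W') ≤ (Real.sqrt (SfV n L M R' G' W') + δ * Real.sqrt (qVV n L M W')) ^ 2)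
    -- leaf V-ONE (square-root shape) and leaf V-REG
    (hONE : ∀ W, blockSpin Q₁ (SfV n L M R' G') W ≤ (Real.sqrt (ScV n M R G W + ε₁ * ρ W) + δ' * Real.sqrt (qWV n M W)) ^ 2)
    (hREG : ∀ (φ : Tor M → Fin d → E) W, Qk W = φ → (∀ W₂, Qk W₂ = φ → ScV n M R G W ≤ ScV n M R G W₂) →
      ρ W ≤ CR * (ScV n M R G W + nsqV M φ))
    (φ : Tor M → Fin d → E) :
    blockSpin Qk (ScV n M R G) φ ≤ blockSpin (Qk ∘ Q₁) (SfV n L M R' G') φ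
        + (2 * δ * Real.sqrt (Λ * (CP * (Λ + 1))) + δ ^ 2 * (CP * (Λ + 1))) * nsqV M φ ∧
      blockSpin (Qk ∘ Q₁) (SfV n L M R' G') φ ≤ blockSpin Qk (ScV n M R G) φ
        + (ε₁ * CR * (Λ + 1) + 2 * δ' * Real.sqrt ((Λ + ε₁ * CR * (Λ + 1)) * (CP * (Λ + 1))) + δ' ^ 2 * (CP * (Λ + 1))) * nsqV M φ := by
  have hL1 : (1 : ℝ) ≤ L := by exact_mod_cast Nat.one_le_iff_ne_zero.mpr (NeZero.ne L)
  have hn0 : (0 : ℝ) < (n : ℝ) ^ d := by have := Nat.pos_of_ne_zero (NeZero.ne n); positivity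
  have hnLd : (0 : ℝ) ≤ ((n : ℝ) * L) ^ d := by positivity
  have hnormW : ∀ W : Tor (fine n M) → Fin d → E, ‖W‖ ^ 2 ≤ ((n : ℝ) * L) ^ d * qWV n M W := fun W => by
    refine (norm_sq_le_nsqV W).trans ?_
    unfold qWV
    rw [mul_pow, mul_comm ((n : ℝ) ^ d), mul_assoc, ← mul_assoc ((n : ℝ) ^ d), mul_inv_cancel₀ hn0.ne', one_mul]
    exact le_mul_of_one_le_left (nsqV_nonneg _ W) (one_le_pow₀ hL1)
  have hnormV : ∀ W' : Tor (fine L (fine n M)) → Fin d → E, ‖W'‖ ^ 2 ≤ ((n : ℝ) * L) ^ d * qVV n L M W' := fun W' => by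
    have hnL : (0 : ℝ) < ((n : ℝ) * L) ^ d := by have := Nat.pos_of_ne_zero (NeZero.ne n); positivity
    unfold qVV
    rw [← mul_assoc, mul_inv_cancel₀ hnL.ne', one_mul]
    exact norm_sq_le_nsqV W'
  exact pair_bracket_sqrt (V := Tor (fine L (fine n M)) → Fin d → E) (W := Tor (fine n M) → Fin d → E) (Z := Tor M → Fin d → E)
    (Qk := Qk) (Q₁ := Q₁) (Sc := ScV n M R G) (Sf := SfV n L M R' G') (qW := qWV n M) (qV := qVV n L M) (qZ := nsqV M) (ρ := ρ)
    hQk hQ₁ (continuous_ScV n M R hGc) (continuous_SfV n L M R' hGc') hsurj (ScV_nonneg n M R hG0) (SfV_nonneg n L M R' hG0')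
    (qVV_nonneg n L M) (qWV_nonneg n M) (nsqV_nonneg M) hρ0 hnLd hΛ hCP hCR hδ hε₁ hδ' hnormW hnormV hUBc hUBf hPc hPf hFED hONE hREG φ

/-- **THE ONE-STEP SPECIAL CASE WITH BOND-INDEXED TRANSPORTS, COARSE V-UB DISCHARGED**: `Qk := QvT n M Tl`, `Q₁ := QvT L (fine n M) Tl′` (continuity and
surjectivity from §2, the coarse V-UB binder from §3 with any `Λ ≥ lamV d (n w) C_G (n²C₀)`); the other leaves displayed as in `vector_pair_bracket_sqrt`. [folklore] -/
theorem vector_pair_bracket_sqrt_bond [FiniteDimensional ℂ E]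
    {R : Tor (fine n M) → Fin d → (E →L[ℂ] E)} {R' : Tor (fine L (fine n M)) → Fin d → (E →L[ℂ] E)}
    {Tl Sl : Tor (fine n M) → Fin d → (E →L[ℂ] E)} {Tl' Sl' : Tor (fine L (fine n M)) → Fin d → (E →L[ℂ] E)}
    {G : (Tor (fine n M) → Fin d → E) → ℝ} {G' : (Tor (fine L (fine n M)) → Fin d → E) → ℝ}
    (hTS : ∀ x μ v, Tl x μ (Sl x μ v) = v) (hT : ∀ x μ, ‖Tl x μ‖ ≤ 1) (hS : ∀ x μ, ‖Sl x μ‖ ≤ 1) (hR : ∀ x ν, ‖R x ν‖ ≤ 1)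
    {w : ℝ} (hw0 : 0 ≤ w)
    (hw : ∀ (y : Tor M) (j : Fin d → Fin n) (ν μ : Fin d), (j ν : ℕ) + 1 < n → ‖R (bpt n M y j) ν * Sl (bpt n M y j + unitVec (fine n M) ν) μ * Tl (bpt n M y j) μ - 1‖ ≤ w)
    (hd : 1 ≤ d) (hTS' : ∀ x μ v, Tl' x μ (Sl' x μ v) = v)
    (hG0 : ∀ W, 0 ≤ G W) (hGc : Continuous G) {CG C₀ : ℝ} (hCG : 0 ≤ CG) (hC₀ : 0 ≤ C₀)
    (hG : ∀ W, G W ≤ CG * roughV n M R W + C₀ * nsqV (fine n M) W) (hG0' : ∀ W', 0 ≤ G' W') (hGc' : Continuous G')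
    {Λ CP CR δ ε₁ δ' : ℝ} (hΛ : lamV d (n * w) CG ((n : ℝ) ^ 2 * C₀) ≤ Λ) (hCP : 0 ≤ CP) (hCR : 0 ≤ CR) (hδ : 0 ≤ δ) (hε₁ : 0 ≤ ε₁)
    (hδ' : 0 ≤ δ') {ρ : (Tor (fine n M) → Fin d → E) → ℝ} (hρ0 : ∀ W, 0 ≤ ρ W)
    (hUBf : ∀ φ : Tor M → Fin d → E, ∃ W', QvT n M Tl (QvT L (fine n M) Tl' W') = φ ∧ SfV n L M R' G' W' ≤ Λ * nsqV M φ)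
    (hPc : ∀ W, qWV n M W ≤ CP * (ScV n M R G W + nsqV M (QvT n M Tl W)))
    (hPf : ∀ W', qVV n L M W' ≤ CP * (SfV n L M R' G' W' + nsqV M (QvT n M Tl (QvT L (fine n M) Tl' W'))))
    (hFED : ∀ W', ScV n M R G (QvT L (fine n M) Tl' W') ≤ (Real.sqrt (SfV n L M R' G' W') + δ * Real.sqrt (qVV n L M W')) ^ 2)
    (hONE : ∀ W, blockSpin (QvT L (fine n M) Tl') (SfV n L M R' G') W
      ≤ (Real.sqrt (ScV n M R G W + ε₁ * ρ W) + δ' * Real.sqrt (qWV n M W)) ^ 2)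
    (hREG : ∀ (φ : Tor M → Fin d → E) W, QvT n M Tl W = φ → (∀ W₂, QvT n M Tl W₂ = φ → ScV n M R G W ≤ ScV n M R G W₂) →
      ρ W ≤ CR * (ScV n M R G W + nsqV M φ))
    (φ : Tor M → Fin d → E) :
    blockSpin (QvT n M Tl) (ScV n M R G) φ ≤ blockSpin (QvT n M Tl ∘ QvT L (fine n M) Tl') (SfV n L M R' G') φ
        + (2 * δ * Real.sqrt (Λ * (CP * (Λ + 1))) + δ ^ 2 * (CP * (Λ + 1))) * nsqV M φ ∧
      blockSpin (QvT n M Tl ∘ QvT L (fine n M) Tl') (SfV n L M R' G') φ ≤ blockSpin (QvT n M Tl) (ScV n M R G) φ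
        + (ε₁ * CR * (Λ + 1) + 2 * δ' * Real.sqrt ((Λ + ε₁ * CR * (Λ + 1)) * (CP * (Λ + 1))) + δ' ^ 2 * (CP * (Λ + 1))) * nsqV M φ := by
  have hΛ0 : 0 ≤ Λ := (lamV_nonneg (d := d) hCG (by positivity)).trans hΛ
  have hUBc : ∀ φ : Tor M → Fin d → E, ∃ W, QvT n M Tl W = φ ∧ ScV n M R G W ≤ Λ * nsqV M φ := fun φ => by
    obtain ⟨W, hW, hb⟩ := exists_ubV n M hTS hT hS hR hw0 hw hd hCG hC₀ hG φ
    exact ⟨W, hW, hb.trans (mul_le_mul_of_nonneg_right hΛ (nsqV_nonneg M φ))⟩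
  exact vector_pair_bracket_sqrt n L M (continuous_QvT n M Tl) (continuous_QvT L (fine n M) Tl') (QvT_surjective L (fine n M) hTS')
    hG0 hGc hG0' hGc' hΛ0 hCP hCR hδ hε₁ hδ' hρ0 hUBc hUBf hPc hPf hFED hONE hREG φ

end Pair

end Summit.QuantumFields.BalabanUV.T4Continuum.VariationalVectorForm

end
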